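import Mathlib
import HarnessLib
import HarnessLib.Audit
import Summits.ABC.ABC.Statement
import Literature.NumberTheory.DiophantineGeometry.Conductor
import Literature.NumberTheory.EllipticCurves.GaloisAction

/-!
Route: CMRescueSzpiro

CLOSED (retired) 2026-08-16T03:11:52Z by planner-rchoice-ABC-CMRescueSzpiro-target-unre-8b828323-0 — reason: not-a-thesis: target-unreachable (route-choice hold 2026-08-16T02:49Z) — the crux layer (LargePrimeFree, LocalDepthBound, PolySzpiro32; support SplitPrimeFree, InertCongruence, TwoPartBounded) composes only to PolySzpiro32 (polynomial Szpir — note: route-choice by planner-rchoice-…-8b828323 (memo DECISION-CMRescueSzpiro.md attached as route evidence). Why no glue: (1) the tree's B–G (c)⟹(a) (abcLe_of_generalizedSzpiroBG) uses Target only on Frey models; conductor-32p Frey curves are the Catalan/Mersenne/Fermat triples (abc supported on {2,p}, . The file is kept as the record of this route; refuted decls are indexed as negative knowledge (`ledger negatives`).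

# Route CMRescueSzpiro — CM rescue at conductor 32p — bounded prime-power depth of v_p(Δ_min)
(Dahmen–Yazdani + Arai), no split primes (Cartan uniformity); polynomial Szpiro on the family ⇐ one
non-split uniformity crux

It suffices to show the generalized Szpiro conjecture as posed by Bombieri–Gubler, Conj. 12.5.11
(max(|Δ|, |c₄|³) ≤ C(ε)·N_E^{6+ε} over global minimal models), which is equivalent to ABC by
Bombieri–Gubler Thm 12.5.12 — proved in tree
(`Literature.NumberTheory.EllipticCurves.abcLe_iff_generalizedSzpiroBG_holds`).
This route realises the idea card cm-rescue-polynomial-szpiro: it attacks the cheapest OPEN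
conductor rung of
(plain) Szpiro, N_E = 32·p (p an odd prime), the rung between Sz₁ (prime conductor, Mestre–Oesterlé:
the
lowered level 1 is EMPTY) and Sz₂ (2ˢpq, open): at N₀ = 32 the lowered level is non-empty but
CM-ONLY
(dim S₂(Γ₀(32)) = 1, newform 32a with CM by ℤ[i]; S₂(Γ₀(M)) = 0 for M | 16). For E of conductor 32p
put
v := v_p(Δ_min(E)) ≥ 1 (E is multiplicative at p). A prime power ℓⁿ | v makes E[ℓⁿ] unramified at p,
and the
CM mimic forces: split primes ℓ ≥ 11 cannot divide v at all (Cartan uniformity), every prime has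
bounded
depth in v (level lowering mod ℓⁿ + Arai's uniform ℓ-adic image bound), inert primes dividing v
satisfy
p ≡ ±1 (mod ℓ); polynomial Szpiro |Δ_min| ≤ C·p^B on the whole family then hinges on ONE statement —
no prime ℓ > ℓ₀ divides v — the non-split-Cartan uniformity question restricted to this family (crux
#2).
Lean: `∀ ε : ℝ, 0 < ε → ∃ C : ℝ, ∀ W₀ : WeierstrassCurve ℤ, (W₀.baseChange ℚ).IsElliptic → (∀ v :
IsDedekindDomain.HeightOneSpectrum ℤ, (W₀.baseChange ℚ).IsMinimalAt v) → ((max |W₀.Δ| (|W₀.c₄| ^ 3)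
: ℤ) : ℝ) ≤ C * ((W₀.baseChange ℚ).conductorNorm ℤ : ℝ) ^ (6 + ε)` (item `Target`; verbatim the body
of Bombieri–Gubler Conj. 12.5.11 as registered in
`Literature.NumberTheory.EllipticCurves.GeneralizedSzpiroConjectureBG` — `Iff.rfl` — inlined so that
the route names no Literature open-conjecture constant)

## Assembly
Deciding theorem (D-0027 §2.1): `closes : Target → LargePrimeFree → … → RungNecessity → Assembly →
ABC := fun hT … hA => hA hT`, certified by the gate audit (conclusion `ABC` by name, hypotheses =
the 9 items, axioms propext/choice/Quot.sound). The item `Assembly := Target → ABC` is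
Bombieri–Gubler Thm 12.5.12 (c) ⟹ (a), PROVED in tree as
`Literature.NumberTheory.EllipticCurves.abcLe_of_generalizedSzpiroBG` (equivalently the ← direction
of `abcLe_iff_generalizedSzpiroBG_holds`), followed by the `≤`/`<, 0 < C` conversion of `ABC_iff` (C
↦ max C 0 + 1, 0 < rad); provable now in ~12 lines (planner sketch checked rc 0; two candidate
proofs are attached to the old Assembly item). The cruxes are the conductor-32p rung of the target's
Δ-part and compose to PolySzpiro32 (two-layer plan), not to the target.

Rationale: WHY THIS LINE. Mechanism (card cm-rescue-polynomial-szpiro, menu "rigidity & classification"): when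
the level-lowered space
is CM-only, a congruence ρ̄_{E,ℓ} ≅ ρ̄_{32a,ℓ} puts the mod-ℓ image of a NON-CM curve inside a
Cartan
normaliser, and two uniformity theorems imported from the arithmetic of modular curves / ℓ-adic
images take
over: rational points on X_split⁺(ℓ) = X₀⁺(ℓ²) are CM or cusps for ℓ ≥ 11 (BiluParentRebolledo2013,
BalakrishnanEtAl2019), and ρ_{E,ℓ^∞}(G_ℚ) ⊇ 1 + ℓ^{n(ℓ)}M₂(ℤ_ℓ) uniformly in non-CM E/ℚ (Arai2008
Thm 1.2);
the bridge from "ℓⁿ | v_p(Δ_min)" to "image mod ℓⁿ inside a Cartan normaliser" is level lowering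
modulo
prime powers in the one-newform case R_min = 𝕋_min = ℤ_ℓ (DahmenYazdani2012 Thm 2 / Prop 6, via
Wiles1995, TaylorWiles1995, Diamond1996), and the residually reducible primes are closed by a
compactness
argument ending in the residually-reducible Fontaine–Mazur theorem (Pan2022 Thm 1.0.2,
SkinnerWiles1999)
— the limit representation would be modular of level 32, but 32a is residually irreducible. Imports:
modular
curves/rational points (Cartan), deformation theory (R = 𝕋 mod ℓⁿ), ℓ-adic open-image uniformity; no
transcendence, no Baker. What it does that nothing in the ledger does: the ω-ladder card certifies
Sz₁ and
declares 2ˢpq the first open rung; DarmonMerel1997 §4 used the CM-only levels 32, 27 + Cartan curves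
for FREY
curves of xⁿ + yⁿ = z², z³ only; here the curves are arbitrary, DEPTH (not just occurrence) of
primes in v is
bounded, and polynomial Szpiro on an infinite conductor family is isolated as equivalent (given
theorems) to a
single thin-family uniformity statement. Known today on the family: only log|Δ_min| ≪ N log N
(MurtyPasten2013, Pasten2024).

RANKED CRUXES. #0 Target (target) — the generalized Szpiro conjecture, Bombieri–Gubler Conj.
12.5.11: for every ε > 0 there is C with max(|Δ|, |c₄|³) ≤ C·N_E^{6+ε} for every global minimal
Weierstrass model over ℤ of an elliptic curve over ℚ; equivalent to ABC (B–G Thm 12.5.12, in tree).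
The cruxes below are the conductor-32p rung of its Δ-part. (why it might fail: it is equivalent to
ABC; Masser 1990 shows the ε cannot be dropped
(Literature.Barriers.ABC.SzpiroEpsilonCannotBeDropped), so any exponent-6-flat strengthening is
false.) [BombieriGubler2006, Oesterle1988, Masser1990]
#2 LargePrimeFree (crux) — there is ℓ₀ such that for every elliptic curve E/ℚ of conductor 32p (p an
odd prime) no prime ℓ > ℓ₀ divides v_p(Δ_min(E)). Given SplitPrimeFree (#4) and Mazur's isogeny
theorem (`mazur_isogeny_irreducible`, ℓ > 163), this is the statement that for all large primes ℓ ≡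
3 (mod 4) no conductor-32p curve has E[ℓ] ≅ E₀[ℓ] as Galois modules, E₀ = 32a (y² = x³ − x, CM by
ℤ[i]) — the non-split-Cartan case of Serre's uniformity question restricted to this family (such E
gives a non-CM point of X_ns⁺(ℓ)(ℚ) whose quadratic character is χ₋₄ and which is cusp-adjacent at p
with p ≡ ±1 (mod ℓ), ℓ | v_p(j)). Implied by Serre uniformity; this is the route's bet and its only
genuinely open node. [deps: SplitPrimeFree] [difficulty: open-problem] (why it might fail: It is
non-split-Cartan Serre uniformity cut to a thin family: formal immersion, Runge (the twist
X_{32a}(ℓ) has ONE Galois orbit of cusps) and quadratic Chabauty (ℓ ≤ 17) all fail; Le Fourn–Lemos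
Thm 1.2 gives only 'image = full normaliser', which the CM mimic satisfies.) [Serre1972,
LefournLemos2021, Lemos2018, BiluParentRebolledo2013, DarmonMerel1997, Mazur1978]
#3 LocalDepthBound (crux) — for every prime ℓ there is n₀ = n₀(ℓ) such that ℓ^{n₀} ∤ v_p(Δ_min(E))
for every E/ℚ of conductor 32p. Route: ℓⁿ | v ⟹ E[ℓⁿ] unramified at p (Tate curve) and finite flat
at ℓ (good reduction; or ℓ = p with ℓⁿ | v_ℓ). (i) ρ̄_{E,ℓ} irreducible, ℓ ≥ 5: Ribet ⟹ ρ̄_{E,ℓ} ≅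
ρ̄_{32a,ℓ}; E[ℓ] is strongly irreducible (ℓ ≥ 5, semistable at ℓ) and (32a, (ℓ)) is the unique
newform/prime at level 32, so Dahmen–Yazdani Thm 2 / Prop 6 (R_min = 𝕋_min = ℤ_ℓ; minimality at 2 is
automatic because inertia at 2 acts through a finite group of order dividing 8 for both curves)
gives E[ℓⁿ] ≅ E₀[ℓⁿ]; the image of ρ_{E,ℓ^∞} mod ℓⁿ then lies in the normaliser of (ℤ[i]/ℓⁿ)^×,
which meets ker(GL₂(ℤ/ℓⁿ) → GL₂(ℤ/ℓⁿ⁻¹)) in ℓ² < ℓ⁴ elements, so the image does not contain 1 +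
ℓⁿ⁻¹M₂(ℤ_ℓ); Arai Thm 1.2 (E is non-CM since v_p(j) < 0) gives n ≤ n(ℚ, ℓ). (ii) ρ̄_{E,ℓ} reducible,
ℓ ≥ 5: if ℓ^k | v_{p_k}(Δ_min(E_k)) with p_k → ∞, a compactness argument over G_{ℚ,{2,ℓ,∞}} extracts
an ℓ-adic limit ρ_∞, flat at ℓ (Raynaud), det = cyclotomic, conductor 2⁵ away from ℓ, residually
reducible, with integer Frobenius traces |a_q| ≤ 2√q — hence absolutely irreducible (a reducible
flat limit has a_q = χ₁(q) + qχ₂(q), too big) — so modular of weight 2 and level 32 by Pan 2022 Thm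
1.0.2 (or Skinner–Wiles in the ordinary case): impossible, 32a is residually irreducible at every
odd ℓ. (iii) ℓ = 2: 2 | v ⟹ ℚ(E[2]) unramified outside 2 ⟹ (no cubic field is unramified outside 2)
a rational 2-torsion point ⟹ Ivorra 2004 Thm 5: v ∈ {1, 2}. (iv) ℓ = 3 as (i)/(ii) with the extra
provisos. [difficulty: L] (why it might fail: ℓ = 3 needs strong irreducibility of ρ̄_{32a,3} and
Pan's p = 3 proviso, unchecked; the compact-limit step of (ii) (flat limit, conductor exactly 32,
trace integrality) is assembled here, not in print; Arai's uniform n(ℚ,ℓ) is ineffective (Faltings),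
so n₀ is not computed.) [DahmenYazdani2012, Arai2008, Pan2022, SkinnerWiles1999, Ivorra2004,
Ribet1990, Diamond1996, Wiles1995, TaylorWiles1995]
#4 SplitPrimeFree (crux) — for E/ℚ of conductor 32p and a prime ℓ ≥ 11 with ℓ ≡ 1 (mod 4) and
ρ̄_{E,ℓ} irreducible, ℓ ∤ v_p(Δ_min(E)). Line: ℓ | v ⟹ ρ̄_{E,ℓ} unramified at p (finite at p if ℓ =
p) ⟹ Ribet: ρ̄_{E,ℓ} ≅ ρ̄_{32a,ℓ}, whose image lies in the normaliser of a SPLIT Cartan (ℓ splits in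
ℚ(i)) ⟹ E defines a rational point of X_split⁺(ℓ) ≅ X₀⁺(ℓ²) ⟹ CM or cusp (Bilu–Parent–Rebolledo 2013
for ℓ ≥ 11, ℓ ≠ 13; Balakrishnan–Dogra–Müller–Tuitman–Vonk 2019 for ℓ = 13) ⟹ contradiction: E is
multiplicative at p, so j(E) ∉ ℤ and E is not CM. This is Darmon–Merel's §4 playbook run on ALL
curves of the conductor instead of Frey curves; it is the route's certifiable payload (modulo named
facts) and one half of LargePrimeFree. [difficulty: M] (why it might fail: Low risk, every step is
in print; slips are possible only at ℓ = p (needs 'E[p] finite at p' from p | v_p(Δ_min) before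
lowering) and in certifying that the mod-ℓ image of 32a sits in the split-Cartan normaliser for
every ℓ ≡ 1 (mod 4) (CM by the maximal order ℤ[i]).) [Ribet1990, BiluParentRebolledo2013,
BalakrishnanEtAl2019, DarmonMerel1997, Mazur1978, Serre1972]
#5 PolySzpiro32 (crux) — polynomial Szpiro on the conductor-32p family: there are B, C with
|Δ_min(E)| ≤ C·p^B for every elliptic curve E/ℚ of conductor 32p, p an odd prime (equivalently
v_p(Δ_min(E)) ≤ B). Today only log|Δ_min| ≪ p log p is known on the family (Murty–Pasten, Pasten Thm
1.9); ABC gives B = 6 + ε; Mestre–Oesterlé's Sz₁ (prime conductor) is the model. It follows from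
LargePrimeFree + LocalDepthBound + TwoPartBounded by arithmetic (two-layer plan); B is ineffective
through Arai. [deps: LargePrimeFree, LocalDepthBound, TwoPartBounded] [difficulty: open-problem]
(why it might fail: False only if ABC fails on this family (ABC ⟹ the bound with B = 6+ε, in tree
via szpiro_of_abcLe_holds; see RungNecessity); unconditionally it inherits the openness of
LargePrimeFree — a conductor-32p sequence with v_p(Δ_min) → ∞ would refute ABC itself.)
[MurtyPasten2013, Pasten2024, MestreOesterle1989, Oesterle1988]
#9 InertCongruence (support) — for E/ℚ of conductor 32p and a prime ℓ ≥ 5, ℓ ≡ 3 (mod 4), ℓ ≠ p,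
with ρ̄_{E,ℓ} irreducible and ℓ | v_p(Δ_min(E)): p² ≡ 1 (mod ℓ). (Ribet lowering gives image ⊂
normaliser of a NON-split Cartan; Le Fourn–Lemos Prop 5.2 = Lemos: then E is potentially good at
every prime ≢ ±1 (mod ℓ), but E is multiplicative at p.) Known modulo named facts; it halves the
search space of LargePrimeFree (ℓ ≤ (p+1)/2) and is the cheap certificate refuters test data
against. [difficulty: M] [LefournLemos2021, Lemos2018, Ribet1990]
#9 TwoPartBounded (support) — there is A such that Δ_min(E) divides 2^A·p^{v_p(Δ_min(E))} for every
E of conductor 32p: only 2 and p divide Δ_min (`radical_conductorNorm_eq`), and f₂ = 5 forces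
potentially good reduction at 2 (a twisted Tate curve has f₂ ∈ {1, 4, 6}), whence v₂(Δ_min) is
bounded by Tate's algorithm (Kraus's/Papadopoulos's tables for p = 2). Glue for PolySzpiro32.
[difficulty: M] [Silverman1994, Kraus1989, Ogg1967]
#9 RungNecessity (support) — ABC implies PolySzpiro32 (with B = 7, say): ABC ⟹ Szpiro
(`szpiro_of_abcLe_holds`, Silverman AEC VIII.11.5(b)) ⟹ |Δ_min| ≤ C·(32p)^{6+ε}. Provable now;
records that the rung is a necessary waypoint, so ¬PolySzpiro32 is a refutation target for ABC
(negative side). [difficulty: provable-now] [SilvermanAEC2009, Oesterle1988]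

TWO-LAYER PLAN. PolySzpiro32 ⇐ LargePrimeFree → LocalDepthBound → TwoPartBounded → PolySzpiro32
(glue = arithmetic: v = ∏_{ℓ ≤ ℓ₀} ℓ^{e_ℓ}
with e_ℓ < n₀(ℓ), so v ≤ ∏_{ℓ ≤ ℓ₀} ℓ^{n₀(ℓ)} =: B and |Δ_min| = 2^{a}p^{v} ≤ 2^A p^B); k = 3.
LargePrimeFree ⇐ SplitPrimeFree(ℓ > 163, irreducibility from `mazur_isogeny_irreducible`) →
InertLargePrimeFree →
LargePrimeFree, where InertLargePrimeFree (ℓ ≡ 3 mod 4 only) is the genuinely open child; k = 2.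
Filed only when a crux closes.

KILL CRITERIA. A conductor-32p curve with a prime ℓ ≥ 11, ℓ ≡ 1 (mod 4), ρ̄ irreducible, dividing
v_p(Δ_min) refutes SplitPrimeFree and
exposes an error in the lowering bookkeeping — close (refuted:SplitPrimeFree). An explicit ℓ ≥ 5
with unbounded ℓ-depth on
the family refutes LocalDepthBound — close. A conductor-32p sequence with v_p(Δ_min) → ∞ refutes
PolySzpiro32 AND ABC
(RungNecessity): the route then turns into the negative witness. If LargePrimeFree is refuted
(infinitely many primes occur
in v) while LocalDepthBound stands, v is unbounded too — same consequence. Expected stall, not kill: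
LargePrimeFree open;
then the deliverable is the certified partial theorem SplitPrimeFree ∧ LocalDepthBound ∧
InertCongruence ("v_p(Δ_min) is
odd or 2, free of split primes ≥ 11, of bounded depth at every prime, inert prime divisors ℓ satisfy
p ≡ ±1 (ℓ)") and the
route goes dormant rather than closed. A proof of Serre uniformity (non-split case) elsewhere closes
LargePrimeFree at once.

NOT DECOMPOSED YET. Sibling rungs with CM-only lowered level: 27p (27a, CM by ℤ[ζ₃]; split/inert by
ℓ mod 3), and 36p, 49p, 64p for curves
potentially good at 3, 7, 2 (the potentially multiplicative ones twist down to 6p, 7p, 2p — other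
cards); the (3,3,ℓ)
generalized-Fermat payload of the card; an EFFECTIVE n₀(ℓ) (Arai Thm 1.3 gives n(ℓ) = 0 for ℓ ≥ 23
outside a finite
exceptional j-set; Rouse–Sutherland–Zureick-Brown ℓ-adic images would make B explicit); the ℓ = 3
details; the
named-fact filings each item needs (Ribet lowering, BPR 2013, BDMTV 2019, Dahmen–Yazdani Prop 6,
Arai Thm 1.2, Pan
Thm 1.0.2, Ivorra Thm 5, Le Fourn–Lemos Prop 5.2) are left to grounders/provers per item (`--kind
cite`).

CHEAPEST FALSIFIER. A Cremona/LMFDB census of all E/ℚ with conductor 32p, p < 15625 (N < 500000):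
tabulate v = v_p(Δ_min) and factor it.
Predictions: v = 2 exactly for Ivorra's curves (p − 1, p − 8 or p + 8 a square), otherwise v odd; no
prime ℓ ≥ 11 with
ℓ ≡ 1 (mod 4) divides any v; a prime ℓ ≥ 7, ℓ ≡ 3 (mod 4) divides v only when p ≡ ±1 (mod ℓ); max v
small (single
digits). One counterexample to the second prediction kills SplitPrimeFree. Not run here: `kit
compute` socket absent at filing.

NUMBERS. dim S₂(Γ₀(32)) = 1 (newform 32a, CM by ℤ[i]); S₂(Γ₀(M)) = 0 for M | 16. Arai 2008 Thm 1.3: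
n(ℓ) = 0 for ℓ ≥ 23, 1 for
ℓ ∈ {11,13,17,19}, 2 (ℓ=7), 3 (ℓ=5), 5 (ℓ=3), 11 (ℓ=2) outside a finite exceptional set of
j-invariants; Thm 1.2: uniform
n(ℚ, ℓ) exists (ineffective). Bilu–Parent–Rebolledo 2013: X₀⁺(p^r)(ℚ) trivial for p ≥ 11, p ≠ 13, r
≥ 2; BDMTV 2019:
X_s⁺(13)(ℚ) = 6 CM points + 1 cusp. Le Fourn–Lemos 2021 Thm 1.2: for p > 1.4·10⁷ a non-surjective
mod-p image of a
non-CM E/ℚ IS the full non-split normaliser (no integrality of j — the card's recollection was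
wrong, READ p.3); Prop 5.2:
non-split image ⟹ potentially good at primes ≢ ±1 (mod p). Ivorra 2004 Thm 5 (READ pp. 12–13):
conductor-32p curves with
a rational 2-torsion point exist iff p − 1, p − 8 or p + 8 is a square, with Δ_min ∈ {±2⁶p, −2¹²p²,
±2⁹p²}, so v ∈ {1,2}.
Dahmen–Yazdani 2012 Thm 2 (READ §2): ℓ^r | v_p(Δ) for p | M, ℓ² ∤ N, E[ℓ] strongly irreducible,
unique (f, λ) at level
N₀ with λ unramified ⟹ ρ^E_{ℓ^r} ≅ ρ^f_{λ^r}. Baseline on the family: log|Δ_min| ≪ N log N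
(Murty–Pasten 2013;
Pasten 2024 Thm 1.9). Sz₁: prime conductor ⟹ Δ_min | p⁵ up to isogeny (Mestre–Oesterlé 1989, Serre
1987).

DEFINITION REQUESTS. None at open: conductor (`WeierstrassCurve.conductorNorm`), minimal
discriminant (`minimalDiscriminantNorm`), mod-ℓ
irreducibility (`HasIrreducibleModPGaloisRep`), Mazur primes (`mazur_isogeny_irreducible`) all
exist. Cite facts wanted
later (per item, by grounders): Ribet1990 Thm 1.1 lowering; BiluParentRebolledo2013 main theorem;
BalakrishnanEtAl2019;
DahmenYazdani2012 Prop 6; Arai2008 Thm 1.2 (statable with `galoisRepTorsion`); Pan2022 Thm 1.0.2;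
Ivorra2004 Thm 5;
LefournLemos2021 Prop 5.2.

Novelty: Searches (2026-08-15; local lit daemon down, zbMATH cascade used): zbMATH "Szpiro conjecture
elliptic curves conductor 32p" (0),
"minimal discriminant elliptic curves conductor 2^m p" (5, none relevant: Goldfeld 1990, Frey 1987,
Parshin 1988),
"uniform lower bound Galois images elliptic curves Arai" (→ Arai2008 ✓ READ Thms 1.1–1.3), "Le Fourn
Lemos normaliser nonsplit
Cartan" (→ LefournLemos2021 ✓ READ Thm 1.2, Prop 5.2), "Bilu Parent Rebolledo X_0^+(p^r)" (→
BiluParentRebolledo2013),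
"level-lowering higher congruences modular forms" (→ DahmenYazdani2012 ✓ READ Thm 2/Prop 6,
ChenKimingWiese2013, TsakniasWiese2017),
"Fontaine-Mazur residually reducible Pan" (→ Pan2022 ✓ READ Thm 1.0.2), "courbes elliptiques point
d'ordre 2 conducteur"
(→ Ivorra2004 ✓ READ Thm 5), "Serre uniformity rational cyclic isogenies" (→ Lemos2018), "Frey Mazur
conjecture uniform
congruences" (0); the refuter novelty audit of the card (2026-08-15) additionally ran zbMATH 'Szpiro
conjecture conductor 2p'
(→ Oesterlé 1988 only), 'elliptic curves conductor 32p' (0), galaxy --star all 'conductor 32p' (0)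
and READ DarmonMerel1997 §4.
Nearest prior art found: DarmonMerel1997 §4, Prop 4.1 (levels 32 and 27 are CM-only, ρ̄ of the Frey
curves of xⁿ+yⁿ = z², z³
lands in a Cartan normaliser, closed by X_split/X_nonsplit points + winding quotients) — the card's
steps (1)–(2) for Frey
curves; DahmenYazdani2012 (level lowering mod ℓⁿ, for twisted Fermat equations); Arai2008 (uniform
ℓ-adic lower bound);
MestreOesterle  [refs: Arai2008, LefournLemos2021, BiluParentRebolledo2013, DahmenYazdani2012, Pan2022, Ivorra2004, Lemos2018, DarmonMerel1997, MestreOesterle1989]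

Barriers (technique_class: cartan-uniformity-szpiro, lowering-mod-ln, arai-image): - technique_class: cartan-uniformity-szpiro, lowering-mod-ln, arai-image
- Literature.Barriers.ABC.SzpiroEpsilonCannotBeDropped: not engaged — PolySzpiro32 claims SOME
exponent B on a family with ω(N) = 2, while Masser's witness families have ω(N) → ∞; the Target
keeps its ε.
- Literature.Barriers.ABC.BakerMethodBounds: not engaged — no linear forms in logarithms anywhere;
the mechanism is Galois-theoretic (level lowering mod ℓⁿ, Cartan modular curves, open image) and its
output (polynomial in p, ineffective) has a shape Baker's method does not produce on this family.
- Literature.Barriers.ABC.IUTDisputedClaim: independent of IUT.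
- Uncatalogued wall (candidate barrier entry): Serre's uniformity question, non-split Cartan case
(Serre1972 §4.3; open after BiluParentRebolledo2013, LefournLemos2021). The line does NOT evade it:
crux #2 LargePrimeFree is that question restricted to conductor-32p curves congruent to the fixed CM
form 32a; the bet is that the restriction (fixed partner, p ≡ ±1 (ℓ), cusp-adjacency at p of order
v/ℓ ≥ 1) is weaker than full uniformity, and everything else in the route is theorem-level.
- Log-cardinality / Wieferich-type walls recorded in the ideas index: not met — no height is bounded
by the order of a finite group; depth is bounded by Arai's open-image uniformity (Faltings inside),
which is exactly why B is ineffective (flagged in Not decomposed yet).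
- Negatives index: empty at filing (`ledger negatives --problem ABC`: 0 refuted statements).

History (route lifecycle, newest last):
- 2026-08-15T16:18:42Z · rev 3: restated Target (stmt-ABC-3039), Assembly (stmt-ABC-3047) — route-repair (glue + cone guardrail): deciding theorem closes := fun hT … hA => hA hT certified (gate audit ok, extra=[]); Assembly restated Target → ABC (hypot (planner-rbadge-ABC-CMRescueSzpiro-249f5d43-g4-0)
- 2026-08-16T02:17:46Z · AUTO-CRUX: 1 conjecture-grade item(s) promoted to crux (Target) — refuter vetting / tiering apply (operator:999:1362873)
- 2026-08-16T03:11:52Z · CLOSED retired — not-a-thesis: target-unreachable (route-choice hold 2026-08-16T02:49Z) — the crux layer (LargePrimeFree, LocalDepthBound, PolySzpiro32; support SplitPrimeFree, InertCongruence, TwoPartBounded) compose (planner-rchoice-ABC-CMRescueSzpiro-target-unre-8b828323-0)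

sub-problem: ABC · status: closed(retired) · opened planner-plancard-ABC-ABC-cm-rescue-polynomial-22a7cb69-0 2026-08-15T11:10:24Z · rev 3 · ledger route-ABC-CMRescueSzpiro
GENERATED by the gate from the ledger (D-0016/17). Provers cite these decls: `theorem foo : Summit.ABC.ABC.Theses.CMRescueSzpiro.<Decl> := …` in Summits/ABC/ABC/Theorems/<Name>.lean.
-/

namespace Summit.ABC.ABC.Theses.CMRescueSzpiro

open scoped BigOperators Topology Manifold Classical MeasureTheory ProbabilityTheory Matrix InnerProductSpace ComplexConjugate ContinuousMap
open Filter Set Function TopologicalSpace MeasureTheory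

attribute [summit_statement] _root_.ABC

open Literature.Abc

-- earlier Target (stmt-ABC-3039, replaced 2026-08-15T16:18:42Z -> stmt-ABC-10576): retired by None — Literature.NumberTheory.EllipticCurves.GeneralizedSzpiroConjectureBG
/-- item stmt-ABC-10576 · target · rank 0 · closed · moot by None · by planner
why it might fail: Equivalent to ABC over ℚ (Bombieri–Gubler Thm 12.5.12, in tree: abcLe_iff_generalizedSzpiroBG_holds), hence open; the ε is essential — Masser 1990 gives |Δ_min| > N^6·exp(c·√(log N)/log log N) infinitely often (Literature.Barriers.ABC.SzpiroEpsilonCannotBeDropped).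
sources: BombieriGubler2006, Masser1990, Oesterle1988
[target] the generalized Szpiro conjecture, Bombieri–Gubler Conj. 12.5.11: for every ε > 0 there is
C with max(|Δ|, |c₄|³) ≤ C·N_E^{6+ε} for every global minimal Weierstrass model over ℤ of an
elliptic curve over ℚ; equivalent to ABC (B–G Thm 12.5.12, in tree:
abcLe_iff_generalizedSzpiroBG_holds). Stated inline — verbatim the body of
Literature.NumberTheory.EllipticCurves.GeneralizedSzpiroConjectureBG (Iff.rfl) — so the route's cone
names no Literature open-conjecture constant (conjectures are route items, not Literature debt). The
cruxes below are the conductor-32p rung of its Δ-part. [difficulty: open-problem] -/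
@[route_item "route-ABC-CMRescueSzpiro"]
def Target : Prop :=
  ∀ ε : ℝ, 0 < ε → ∃ C : ℝ, ∀ W₀ : WeierstrassCurve ℤ, (W₀.baseChange ℚ).IsElliptic → (∀ v : IsDedekindDomain.HeightOneSpectrum ℤ, (W₀.baseChange ℚ).IsMinimalAt v) → ((max |W₀.Δ| (|W₀.c₄| ^ 3) : ℤ) : ℝ) ≤ C * ((W₀.baseChange ℚ).conductorNorm ℤ : ℝ) ^ (6 + ε)

/-- item stmt-ABC-3040 · crux · rank 2 · closed · moot by None · by planner
why it might fail: It is Serre uniformity in its one open case: E[ℓ]≅32a[ℓ] (ℓ≡3 mod 4) has image exactly C_ns⁺(ℓ), the possibility left for every ℓ>37 after Zywina, Le Fourn–Lemos, Furio–Lombardo; Runge/formal immersion fail on X_ns⁺(ℓ), quadratic Chabauty is per-level (ℓ≤17); nothing known uses the 32p restriction.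
sources: Serre1972, arXiv:2305.17780, LefournLemos2021, Lemos2018, BalakrishnanEtAl2019, arXiv:2608.10919
[crux] there is ℓ₀ such that for every elliptic curve E/ℚ of conductor 32p (p an odd prime) no prime
ℓ > ℓ₀ divides v_p(Δ_min(E)). Given SplitPrimeFree (#4) and Mazur's isogeny theorem
(`mazur_isogeny_irreducible`, ℓ > 163), this is the statement that for all large primes ℓ ≡ 3 (mod
4) no conductor-32p curve has E[ℓ] ≅ E₀[ℓ] as Galois modules, E₀ = 32a (y² = x³ − x, CM by ℤ[i]) —
the non-split-Cartan case of Serre's uniformity question restricted to this family (such E gives a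
non-CM point of X_ns⁺(ℓ)(ℚ) whose quadratic character is χ₋₄ and which is cusp-adjacent at p with p
≡ ±1 (mod ℓ), ℓ | v_p(j)). Implied by Serre uniformity; this is the route's bet and its only
genuinely open node. [deps: SplitPrimeFree] [difficulty: open-problem] -/
@[route_item "route-ABC-CMRescueSzpiro"]
def LargePrimeFree : Prop :=
  ∃ ℓ₀ : ℕ, ∀ (W : WeierstrassCurve ℚ) [W.IsElliptic] (p ℓ : ℕ), p.Prime → p ≠ 2 → W.conductorNorm ℤ = 32 * p → ℓ.Prime → ℓ₀ < ℓ → ¬ ℓ ∣ padicValNat p (W.minimalDiscriminantNorm ℤ)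

/-- item stmt-ABC-3041 · crux · rank 3 · closed · moot by None · by planner
why it might fail: Not in print: D–Y Thm 2 (arXiv:1009.0284 p.4) assumes ℓ∤v_q(Δ) for q|N₀ and ℓ²∤N, so at N₀=32 Prop 6 (R_min=𝕋=ℤ_ℓ, conductor exactly 32) must be re-run; the reducible-ℓ closure (compact limit → Pan 2022) and ℓ=3 (strong irreducibility, Pan's ω-proviso) are unwritten; n₀ ineffective (Arai/Faltings).
sources: DahmenYazdani2012, arXiv:1009.0284, Arai2008, Pan2022, SkinnerWiles1999, Diamond1996
[crux] for every prime ℓ there is n₀ = n₀(ℓ) such that ℓ^{n₀} ∤ v_p(Δ_min(E)) for every E/ℚ of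
conductor 32p. Route: ℓⁿ | v ⟹ E[ℓⁿ] unramified at p (Tate curve) and finite flat at ℓ (good
reduction; or ℓ = p with ℓⁿ | v_ℓ). (i) ρ̄_{E,ℓ} irreducible, ℓ ≥ 5: Ribet ⟹ ρ̄_{E,ℓ} ≅ ρ̄_{32a,ℓ};
E[ℓ] is strongly irreducible (ℓ ≥ 5, semistable at ℓ) and (32a, (ℓ)) is the unique newform/prime at
level 32, so Dahmen–Yazdani Thm 2 / Prop 6 (R_min = 𝕋_min = ℤ_ℓ; minimality at 2 is automatic
because inertia at 2 acts through a finite group of order dividing 8 for both curves) gives E[ℓⁿ] ≅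
E₀[ℓⁿ]; the image of ρ_{E,ℓ^∞} mod ℓⁿ then lies in the normaliser of (ℤ[i]/ℓⁿ)^×, which meets
ker(GL₂(ℤ/ℓⁿ) → GL₂(ℤ/ℓⁿ⁻¹)) in ℓ² < ℓ⁴ elements, so the image does not contain 1 + ℓⁿ⁻¹M₂(ℤ_ℓ);
Arai Thm 1.2 (E is non-CM since v_p(j) < 0) gives n ≤ n(ℚ, ℓ). (ii) ρ̄_{E,ℓ} reducible, ℓ ≥ 5: if
ℓ^k | v_{p_k}(Δ_min(E_k)) with p_k → ∞, a compactness argument over G_{ℚ,{2,ℓ,∞}} extracts an ℓ-adic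
limit ρ_∞, flat at ℓ (Raynaud), det = cyclotomic, conductor 2⁵ away from ℓ, residually reducible,
with integer Frobenius traces |a_q| ≤ 2√q — hence absolutely irreducible (a reducible flat limit has
a_q = χ₁(q) + qχ₂(q), too big -/
@[route_item "route-ABC-CMRescueSzpiro"]
def LocalDepthBound : Prop :=
  ∀ ℓ : ℕ, ℓ.Prime → ∃ n₀ : ℕ, ∀ (W : WeierstrassCurve ℚ) [W.IsElliptic] (p : ℕ), p.Prime → p ≠ 2 → W.conductorNorm ℤ = 32 * p → ¬ ℓ ^ n₀ ∣ padicValNat p (W.minimalDiscriminantNorm ℤ)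

/-- item stmt-ABC-3043 · crux · rank 5 · closed · moot by None · by planner
why it might fail: Open, Szpiro-strength on an infinite family: unconditionally only log|Δ_min| ≪ N log N (MurtyPasten2013, Pasten2024); in-route ⇔ LargePrimeFree ∧ LocalDepthBound given TwoPartBounded, so a direct attack meets non-split uniformity; false iff v_p(Δ_min) unbounded at N=32p, i.e. ¬ABC (RungNecessity).
sources: MurtyPasten2013, Pasten2024, MestreOesterle1989, Oesterle1988, SilvermanAEC2009
[crux] polynomial Szpiro on the conductor-32p family: there are B, C with |Δ_min(E)| ≤ C·p^B for
every elliptic curve E/ℚ of conductor 32p, p an odd prime (equivalently v_p(Δ_min(E)) ≤ B). Today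
only log|Δ_min| ≪ p log p is known on the family (Murty–Pasten, Pasten Thm 1.9); ABC gives B = 6 +
ε; Mestre–Oesterlé's Sz₁ (prime conductor) is the model. It follows from LargePrimeFree +
LocalDepthBound + TwoPartBounded by arithmetic (two-layer plan); B is ineffective through Arai.
[deps: LargePrimeFree, LocalDepthBound, TwoPartBounded] [difficulty: open-problem] -/
@[route_item "route-ABC-CMRescueSzpiro"]
def PolySzpiro32 : Prop :=
  ∃ B C : ℝ, ∀ (W : WeierstrassCurve ℚ) [W.IsElliptic] (p : ℕ), p.Prime → p ≠ 2 → W.conductorNorm ℤ = 32 * p → (W.minimalDiscriminantNorm ℤ : ℝ) ≤ C * (p : ℝ) ^ B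

/-- item stmt-ABC-3042 · support · rank 4 · closed · moot by None · by planner
why it might fail: Low risk, every step is in print; slips are possible only at ℓ = p (needs 'E[p] finite at p' from p | v_p(Δ_min) before lowering) and in certifying that the mod-ℓ image of 32a sits in the split-Cartan normaliser for every ℓ ≡ 1 (mod 4) (CM by the maximal order ℤ[i]).
sources: Ribet1990, KhareWintenberger2009, BiluParentRebolledo2013, BalakrishnanEtAl2019, DarmonMerel1997, Mazur1978
[crux] for E/ℚ of conductor 32p and a prime ℓ ≥ 11 with ℓ ≡ 1 (mod 4) and ρ̄_{E,ℓ} irreducible, ℓ ∤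
v_p(Δ_min(E)). Line: ℓ | v ⟹ ρ̄_{E,ℓ} unramified at p (finite at p if ℓ = p) ⟹ Ribet: ρ̄_{E,ℓ} ≅
ρ̄_{32a,ℓ}, whose image lies in the normaliser of a SPLIT Cartan (ℓ splits in ℚ(i)) ⟹ E defines a
rational point of X_split⁺(ℓ) ≅ X₀⁺(ℓ²) ⟹ CM or cusp (Bilu–Parent–Rebolledo 2013 for ℓ ≥ 11, ℓ ≠ 13;
Balakrishnan–Dogra–Müller–Tuitman–Vonk 2019 for ℓ = 13) ⟹ contradiction: E is multiplicative at p,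
so j(E) ∉ ℤ and E is not CM. This is Darmon–Merel's §4 playbook run on ALL curves of the conductor
instead of Frey curves; it is the route's certifiable payload (modulo named facts) and one half of
LargePrimeFree. [difficulty: M] -/
@[route_item "route-ABC-CMRescueSzpiro"]
def SplitPrimeFree : Prop :=
  ∀ (W : WeierstrassCurve ℚ) [W.IsElliptic] (p ℓ : ℕ), p.Prime → p ≠ 2 → W.conductorNorm ℤ = 32 * p → ℓ.Prime → 11 ≤ ℓ → ℓ % 4 = 1 → W.HasIrreducibleModPGaloisRep ℓ → ¬ ℓ ∣ padicValNat p (W.minimalDiscriminantNorm ℤ)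

/-- item stmt-ABC-3044 · support · rank 9 · closed · moot by None · by planner
sources: LefournLemos2021, Lemos2018, Ribet1990
[support] for E/ℚ of conductor 32p and a prime ℓ ≥ 5, ℓ ≡ 3 (mod 4), ℓ ≠ p, with ρ̄_{E,ℓ}
irreducible and ℓ | v_p(Δ_min(E)): p² ≡ 1 (mod ℓ). (Ribet lowering gives image ⊂ normaliser of a
NON-split Cartan; Le Fourn–Lemos Prop 5.2 = Lemos: then E is potentially good at every prime ≢ ±1
(mod ℓ), but E is multiplicative at p.) Known modulo named facts; it halves the search space of
LargePrimeFree (ℓ ≤ (p+1)/2) and is the cheap certificate refuters test data against. [difficulty: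
M] -/
@[route_item "route-ABC-CMRescueSzpiro"]
def InertCongruence : Prop :=
  ∀ (W : WeierstrassCurve ℚ) [W.IsElliptic] (p ℓ : ℕ), p.Prime → p ≠ 2 → W.conductorNorm ℤ = 32 * p → ℓ.Prime → 5 ≤ ℓ → ℓ % 4 = 3 → ℓ ≠ p → W.HasIrreducibleModPGaloisRep ℓ → ℓ ∣ padicValNat p (W.minimalDiscriminantNorm ℤ) → p ^ 2 % ℓ = 1

/-- item stmt-ABC-3045 · support · rank 9 · closed · moot by None · by planner
sources: Silverman1994, Kraus1989, Ogg1967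
[support] there is A such that Δ_min(E) divides 2^A·p^{v_p(Δ_min(E))} for every E of conductor 32p:
only 2 and p divide Δ_min (`radical_conductorNorm_eq`), and f₂ = 5 forces potentially good reduction
at 2 (a twisted Tate curve has f₂ ∈ {1, 4, 6}), whence v₂(Δ_min) is bounded by Tate's algorithm
(Kraus's/Papadopoulos's tables for p = 2). Glue for PolySzpiro32. [difficulty: M] -/
@[route_item "route-ABC-CMRescueSzpiro"]
def TwoPartBounded : Prop :=
  ∃ A : ℕ, ∀ (W : WeierstrassCurve ℚ) [W.IsElliptic] (p : ℕ), p.Prime → p ≠ 2 → W.conductorNorm ℤ = 32 * p → W.minimalDiscriminantNorm ℤ ∣ 2 ^ A * p ^ padicValNat p (W.minimalDiscriminantNorm ℤ)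

/-- item stmt-ABC-3046 · support · rank 9 · closed · moot by None · by planner
sources: SilvermanAEC2009, Oesterle1988
[support] ABC implies PolySzpiro32 (with B = 7, say): ABC ⟹ Szpiro (`szpiro_of_abcLe_holds`,
Silverman AEC VIII.11.5(b)) ⟹ |Δ_min| ≤ C·(32p)^{6+ε}. Provable now; records that the rung is a
necessary waypoint, so ¬PolySzpiro32 is a refutation target for ABC (negative side). [difficulty:
provable-now] -/
@[route_item "route-ABC-CMRescueSzpiro"]
def RungNecessity : Prop :=
  ABC → ∃ B C : ℝ, ∀ (W : WeierstrassCurve ℚ) [W.IsElliptic] (p : ℕ), p.Prime → p ≠ 2 → W.conductorNorm ℤ = 32 * p → (W.minimalDiscriminantNorm ℤ : ℝ) ≤ C * (p : ℝ) ^ B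

-- earlier Assembly (stmt-ABC-3047, replaced 2026-08-15T16:18:42Z -> stmt-ABC-10577): retired by None — Literature.NumberTheory.EllipticCurves.GeneralizedSzpiroConjectureBG → ABC
/-- item stmt-ABC-10577 · assembly · rank 1 · closed · moot by None · by planner
sources: BombieriGubler2006, Oesterle1988
[assembly] Target (generalized Szpiro, B–G Conj. 12.5.11) → ABC: Bombieri–Gubler Thm 12.5.12 (c) ⟹
(a), proved in tree (Literature.NumberTheory.EllipticCurves.abcLe_of_generalizedSzpiroBG;
abcLe_iff_generalizedSzpiroBG_holds), then ABC_iff with C ↦ max C 0 + 1 (0 < rad: rad_def +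
radical_ne_zero). Hypothesis is the item Target BY NAME (was the Literature constant:
glue.extra-hypothesis). [difficulty: provable-now] -/
@[route_item "route-ABC-CMRescueSzpiro"]
def Assembly : Prop :=
  Target → ABC

end Summit.ABC.ABC.Theses.CMRescueSzpiro
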